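import Summits.Ventures.PercRepro.Night2CoverBasesFat
import Summits.Ventures.PercRepro.Night2SevenFiveResiduesC

/-!
# PercRepro — the `(7, 5)` cell `(3, 1)` at `|G| = 10` closes through the fat-hyperplane count; residues D (night-2, gen 21)

At `|G| = 10` (`n = |G ∖ K| = 9`) the cell `(3, 1)` was open in `shadowHall_seven_five_of_residuesC` when a NON-basis thin
member misses `≤ 2` points and a basis member misses `≤ 2` («fat 5/2 ∧ basis 2»).  The fat non-basis member gives a
hyperplane `H = cl B₀ ⊇ K` of rank `5` with `|G ∖ H| ≤ 2`, so a target of size `s` (off the coloops) carries at most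
`C(s, 5) − C(s − 2, 5)` covering bases (`card_coverBases_le_of_fat`), and with the chord excess `E = 89/240` of gen 20 the
count sum of `localShadowHall_excess_of_count` is `1.065 ≥ 1` at `n = 9` (`countSum_three_one_nine`; no spread hypothesis
at all).  Without a fat non-basis member every non-basis member misses `≥ 3` points and gen 20's
`localShadowHall_three_one_five_of_excess` applies.  Hence **`localShadowHall_three_one_five_ten`**: the cell `(3, 1)` at
`|G| = 10` with NO hypothesis, and **`shadowHall_seven_five_of_residuesD`**: the `(7, 5)` shadow row modulo the residues
of C with `(3, 1)` now on `11 ≤ |G| ≤ 17` only.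
-/

namespace PercRepro.Shadow

open Finset PerFlat ThmH

/-- The count function of a single fat hyperplane missing `≤ m` points: `C(s, ρ) − C(s − m, ρ)`. -/
noncomputable def cntFat (ρ m s : ℕ) : ℚ := (s.choose ρ : ℚ) - ((s - m).choose ρ : ℚ)

/-- `cntFat 5 2 s > 0` for `6 ≤ s ≤ 9`. -/
theorem cntFat_five_two_pos : ∀ s, 6 ≤ s → s ≤ 9 → 0 < cntFat 5 2 s := by
  intro s h1 h2
  unfold cntFat
  interval_cases s <;> norm_num [Nat.choose_eq_descFactorial_div_factorial, Nat.descFactorial, Nat.factorial]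

/-- `c′ = 1/120` at `(q, d, ρ, k, m₁) = (5, 3, 5, 1, 2)`. -/
theorem cPrimeDGP_three_one_two : cPrimeDGP 5 3 5 1 2 = (1 / 120 : ℚ) := by
  unfold cPrimeDGP capDG reqDGP phiQ; norm_num

/-- The count sum of the cell `(3, 1)` at `n = 9` with the fat count `C(s,5) − C(s−2,5)` and `E = 89/240`:
`(4 · (1/120)/6 + 6/20 + 4/50 + 1/105) / (89/240) = 1.065… ≥ 1`. -/
theorem countSum_three_one_nine : 1 ≤ countSum 9 5 3 (cPrimeDGP 5 3 5 1 2) (89 / 240 : ℚ) (cntFat 5 2) := by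
  rw [cPrimeDGP_three_one_two]
  unfold countSum DGenP.cjG cntFat
  rw [show Finset.Icc 1 (9 - 5) = {1, 2, 3, 4} by decide]
  rw [Finset.sum_insert (by decide), Finset.sum_insert (by decide), Finset.sum_insert (by decide),
    Finset.sum_singleton]
  norm_num [Nat.choose_eq_descFactorial_div_factorial, Nat.descFactorial, Nat.factorial]

variable {α : Type*} [DecidableEq α] {M : Matroid α} [M.Finite]

open scoped Classical in
/-- **The cell `(3, 1)` at `|G| = 10` with a fat non-basis member** (a thin member `B₀` missing `≤ 2` points):
(LI_G) through the fat-hyperplane count of the covering bases. -/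
theorem localShadowHall_three_one_five_ten_of_fat {G : Finset α} (hG : G ∈ flatsQ M (5 + 1))
    (hd : (gr M \ G).card = 3) (hk : kColoops M G = 1)
    (hs : ∀ e ∈ gr M, ∀ f ∈ gr M, e ≠ f → rkN M {e, f} = 2) (hl : ∀ e ∈ gr M, M.Indep {e})
    (hn : G.card = 10) {B₀ : Finset α} (hB₀ : B₀ ∈ thinMembers M 5 G) (hfat : (G \ clF M B₀).card ≤ 2) :
    LocalShadowHall M 5 G := by
  have hk' : kColoops M G + 5 = 5 + 1 := by omega
  have hd' : (gr M \ G).card ≤ 5 := by omega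
  have hm2 : ∀ B ∈ thinMembers M 5 G, 5 ≤ (B \ coloops M G).card → 2 ≤ (G \ clF M B).card :=
    fun B hB _ => two_le_card_sdiff_of_not_lay0 hG hd' (mem_thinMembers.1 hB).1 (mem_thinMembers.1 hB).2
  have hc2 : 0 ≤ cPrimeDGP 5 3 5 (kColoops M G) 2 := by
    rw [hk]; unfold cPrimeDGP capDG reqDGP phiQ; norm_num
  have hn9 : G.card - kColoops M G = 9 := by omega
  have hKG : coloops M G ⊆ G := fun y hy => (mem_coloops.1 hy).1
  have hnK : (G \ coloops M G).card = 9 := by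
    rw [Finset.card_sdiff_of_subset hKG, ← kColoops_eq_card_coloops]; omega
  have hB' : B₀ ∈ membersIn M (Uq M (5 + 2) 5) G := (mem_thinMembers.1 hB₀).1
  have hBU : B₀ ∈ Uq M (5 + 2) 5 := (mem_membersIn.1 hB').1
  have hKH : coloops M G ⊆ clF M B₀ :=
    (coloops_subset_of_mem_thinMembers hG hd' hB₀).trans (subset_clF hBU)
  have hH : M.eRk ((clF M B₀ : Finset α) : Set α) ≤ ((5 : ℕ) : ℕ∞) := by
    rw [coe_clF, M.eRk_closure_eq, (mem_Uq.1 hBU).2.1]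
  refine localShadowHall_excess_of_count (d := 3) (ρ := 5) (m₁ := 2) hG hd (by norm_num) hk' (by norm_num)
    hs hl hc2 hm2 (E := (89 / 240 : ℚ)) (by norm_num) ?_ (cnt := cntFat 5 2) ?_ ?_ ?_
  · intro S _ T hT
    have hT' : T ∈ (S \ coloops M G).powersetCard 5 := by
      unfold coverBases at hT
      exact (Finset.mem_filter.1 hT).1
    have h := sum_faceLoss_union_le (a := (1 / 4 : ℚ)) (b := (1 / 40 : ℚ)) hG hd (by norm_num) hk' (by omega)
      hs hl (by norm_num) (by rw [hnK]; intro m h1 h2; exact DGenP.chord_three_one_9 m h1 (by omega))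
      (by rw [hnK, hk, DGenP.excessBound_three_one_9]; norm_num) hT'
    rw [hnK, hk, DGenP.excessBound_three_one_9] at h
    exact h
  · intro s h1 h2
    rw [hn9] at h2
    exact cntFat_five_two_pos s h1 h2
  · intro S hSG
    have h := card_coverBases_le_of_fat hk' hKH hH hfat hSG
    unfold cntFat
    have h' : ((coverBases M G S 5).card : ℚ) + (((S \ coloops M G).card - 2).choose 5 : ℚ) ≤
        ((S \ coloops M G).card.choose 5 : ℚ) := by exact_mod_cast h
    linarith
  · rw [hn9, hk]
    exact countSum_three_one_nine

open scoped Classical in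
/-- **THE `(7, 5)` CELL `(3, 1)` AT `|G| = 10`, NO HYPOTHESIS**: with a fat non-basis member through the count, without
one through gen 20's partial-spread regime (`m₁ = 3`). -/
theorem localShadowHall_three_one_five_ten {G : Finset α} (hG : G ∈ flatsQ M (5 + 1))
    (hd : (gr M \ G).card = 3) (hk : kColoops M G = 1)
    (hs : ∀ e ∈ gr M, ∀ f ∈ gr M, e ≠ f → rkN M {e, f} = 2) (hl : ∀ e ∈ gr M, M.Indep {e})
    (hn : G.card = 10) : LocalShadowHall M 5 G := by
  by_cases hf : ∃ B ∈ thinMembers M 5 G, 5 ≤ (B \ coloops M G).card ∧ (G \ clF M B).card ≤ 2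
  · obtain ⟨B₀, hB₀, -, hfat⟩ := hf
    exact localShadowHall_three_one_five_ten_of_fat hG hd hk hs hl hn hB₀ hfat
  · push Not at hf
    exact localShadowHall_three_one_five_of_excess hG hd hk hs hl (by omega) (by omega)
      (fun _ _ B hB h5 => by have := hf B hB h5; omega)

section SevenFiveD

variable {α' : Type} [DecidableEq α']

/-- **THE `(7, 5)` SHADOW ROW FOR EVERY FINITE MATROID MODULO THE RESIDUES D**: the residues of
`shadowHall_seven_five_of_residuesC` with `(3, 1)` on `11 ≤ |G| ≤ 17` only (`|G| = 10` closed above). -/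
theorem shadowHall_seven_five_of_residuesD
    (h20 : ∀ (N : Matroid α') [N.Finite] (G : Finset α'), CellHyp N G →
      (gr N \ G).card = 2 → kColoops N G = 0 → FatMember N G 6 3 →
      (FatBasis N G 6 2 ∨ FatMember N G 6 2) → LocalShadowHall N 5 G)
    (h21 : ∀ (N : Matroid α') [N.Finite] (G : Finset α'), CellHyp N G →
      (gr N \ G).card = 2 → kColoops N G = 1 → FatMember N G 5 4 →
      (FatBasis N G 5 3 ∨ FatMember N G 5 3) → LocalShadowHall N 5 G)
    (h30 : ∀ (N : Matroid α') [N.Finite] (G : Finset α'), CellHyp N G →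
      (gr N \ G).card = 3 → kColoops N G = 0 → 10 ≤ G.card → G.card ≤ 13 → FatMember N G 6 2 →
      FatBasis N G 6 2 → LocalShadowHall N 5 G)
    (h31 : ∀ (N : Matroid α') [N.Finite] (G : Finset α'), CellHyp N G →
      (gr N \ G).card = 3 → kColoops N G = 1 → 11 ≤ G.card → G.card ≤ 17 → FatMember N G 5 2 →
      (G.card = 17 → FatBasis N G 5 2) →
      (G.card = 11 ∨ G.card = 15 ∨ G.card = 16 → FatBasis N G 5 3) →
      (12 ≤ G.card ∧ G.card ≤ 14 → FatBasis N G 5 4) → LocalShadowHall N 5 G)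
    (h32 : ∀ (N : Matroid α') [N.Finite] (G : Finset α'), CellHyp N G →
      (gr N \ G).card = 3 → kColoops N G = 2 → FatMember N G 4 2 → LocalShadowHall N 5 G)
    (M : Matroid α') [M.Finite] : ShadowHall M 7 5 (phiK 7 5) := by
  apply shadowHall_seven_five_of_residuesC h20 h21 h30 _ h32
  intro N _ G hcell hd hk h10 h17 hpa hb2 hb3 hb4
  by_cases hG10 : G.card = 10
  · exact localShadowHall_three_one_five_ten hcell.2.2.2 hd hk hcell.1 hcell.2.1 hG10
  · exact h31 N G hcell hd hk (by omega) h17 hpa (fun h => hb2 (Or.inr h)) hb3 hb4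

end SevenFiveD

end PercRepro.Shadow
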